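import Mathlib
import HarnessLib
import Literature.LinearAlgebra.Matrix.PermanentSubperm
import Literature.Computability.AlgebraicComplexity.GLAnnihilator

/-!
# Route SchenstedIndex — the annihilator of `per_3`, I: monomial form and separated cells

Towards the calibration rung `BorderPcPerThree` (stmt-ValiantsHypothesis-16085) by ORBIT DIMENSIONS:
the Lie-algebra annihilator `𝔤𝔩(W)_{per_3} = {Z : ∑_{a,b} Z_{ab} x_a ∂_b per_3 = 0}` (`glAnn`, the tree's
`GLAnnihilator.lean`) has dimension `≤ 4` (`finrank_glAnn_perPoly_three_le_four` in part II,
`Theorems/SchenstedIndexPerThreeAnnihilatorDim.lean`; it is exactly the torus part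
`x_(i,j) ↦ (α_i + β_j) x_(i,j)`, `∑ α + ∑ β = 0`).  Hence `dim Δ(per_3) = 81 − 4 = 77`.  THIS FILE (part I):
the monomial form of `∑ Z_{ab} x_a ∂_b per_3` and the vanishing of `Z_{ab}` for cells `a, b` in different
rows AND columns.

PROOF (explicit, kernel-checked linear algebra on the cubic `∑ Z_{ab} x_a ∂_b per_3`): with
`∂ per_3/∂x_(r,c) = x_(r+1,c+1) x_(r+2,c+2) + x_(r+1,c+2) x_(r+2,c+1)` (indices mod 3,
`pderiv_perPoly_three`) every `x_a ∂_b per_3` is a sum of two monomials indexed by 3-element multisets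
of cells (`X_mul_pderiv_perPoly_three`); extracting coefficients of well-chosen monomials (`coeff` at
`Multiset.toFinsupp D`, the multiset equalities decided by `decide`) gives: `Z_{ab} = 0` when `a, b`
differ in row AND column (private monomials); `Z_{(i,j),(i,c)} = 0`, `j ≠ c`, from the three relations
`∑_{i ≠ s} Z_{(i,j),(i,c)} = 0` (an odd cycle); the same for equal columns; and the six permutation
relations `∑_{a ∈ τ} Z_{aa} = 0` on the diagonal, after which `Z` is determined by four diagonal
entries (`glAnn_perPoly_three_injective_probe`).  Route-independent (no `Theses` import).

HONEST FRAMING: a finite computation about `per_3`; nothing here bears on `VP ≠ VNP`.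
-/

set_option linter.dupNamespace false

noncomputable section

namespace Summit.ValiantsHypothesis.ValiantsHypothesis.Theorems.SchenstedIndex

open MvPolynomial Matrix
open Literature.Computability.AlgebraicComplexity

/-! ## The cubic `∑ Z_{ab} x_a ∂_b per_3` in monomials -/

/-- `per_3` written out (row expansion `Matrix.permanent_fin_three_row`). -/
theorem perPoly_three_eq :
    perPoly (Fin 3) ℂ =
      X (0, 0) * (X (1, 1) * X (2, 2) + X (1, 2) * X (2, 1)) +
      X (0, 1) * (X (1, 0) * X (2, 2) + X (1, 2) * X (2, 0)) +
      X (0, 2) * (X (1, 0) * X (2, 1) + X (1, 1) * X (2, 0)) := by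
  rw [perPoly, Matrix.permanent_fin_three_row]
  simp only [Matrix.mvPolynomialX_apply]

/-- The partial derivatives of `per_3`:
`∂ per_3 / ∂ x_(r,c) = x_(r+1,c+1) x_(r+2,c+2) + x_(r+1,c+2) x_(r+2,c+1)` (indices mod `3`: the `2 × 2`
permanent of the complementary rows and columns). -/
theorem pderiv_perPoly_three (r c : Fin 3) :
    pderiv (r, c) (perPoly (Fin 3) ℂ) =
      X (r + 1, c + 1) * X (r + 2, c + 2) + X (r + 1, c + 2) * X (r + 2, c + 1) := by
  rw [perPoly_three_eq]
  fin_cases r <;> fin_cases c <;>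
    · simp [pderiv_X, Derivation.leibniz]
      try ring

/-- A triple product of variables as the monomial of a three-element multiset. -/
theorem X_mul_X_mul_X_eq_monomial {σ : Type*} [DecidableEq σ] (a p q : σ) :
    (X a * (X p * X q) : MvPolynomial σ ℂ) =
      monomial (Multiset.toFinsupp ({a, p, q} : Multiset σ)) 1 := by
  have h : Multiset.toFinsupp ({a, p, q} : Multiset σ) =
      Finsupp.single a 1 + (Finsupp.single p 1 + Finsupp.single q 1) := by
    rw [Multiset.toFinsupp_eq_iff]
    simp only [map_add, Finsupp.toMultiset_single, one_smul, Multiset.insert_eq_cons,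
      Multiset.singleton_add]
  rw [h, X, X, X, monomial_mul, monomial_mul]
  simp

/-- `x_a · ∂ per_3/∂ x_(r,c)` as two multiset monomials. -/
theorem X_mul_pderiv_perPoly_three (a : Fin 3 × Fin 3) (r c : Fin 3) :
    X a * pderiv (r, c) (perPoly (Fin 3) ℂ) =
      monomial (Multiset.toFinsupp
        ({a, (r + 1, c + 1), (r + 2, c + 2)} : Multiset (Fin 3 × Fin 3))) 1 +
      monomial (Multiset.toFinsupp
        ({a, (r + 1, c + 2), (r + 2, c + 1)} : Multiset (Fin 3 × Fin 3))) 1 := by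
  rw [pderiv_perPoly_three, mul_add, X_mul_X_mul_X_eq_monomial, X_mul_X_mul_X_eq_monomial]

/-- The annihilator condition `Z · per_3 = 0` with every `x_a ∂_b per_3` written in monomials. -/
theorem sum_monomial_eq_zero_of_mem_glAnn_perPoly_three
    {Z : Matrix (Fin 3 × Fin 3) (Fin 3 × Fin 3) ℂ} (hZ : Z ∈ glAnn (perPoly (Fin 3) ℂ)) :
    ∑ a : Fin 3 × Fin 3, ∑ r : Fin 3, ∑ c : Fin 3, Z a (r, c) •
      ((monomial (Multiset.toFinsupp
          ({a, (r + 1, c + 1), (r + 2, c + 2)} : Multiset (Fin 3 × Fin 3))) (1 : ℂ)) +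
        monomial (Multiset.toFinsupp
          ({a, (r + 1, c + 2), (r + 2, c + 1)} : Multiset (Fin 3 × Fin 3))) 1) = 0 := by
  rw [mem_glAnn_iff] at hZ
  simp_rw [Fintype.sum_prod_type (f := fun b : Fin 3 × Fin 3 =>
    Z _ b • (X _ * pderiv b (perPoly (Fin 3) ℂ))), X_mul_pderiv_perPoly_three] at hZ
  exact hZ

/-! ## Cells differing in row and column: `Z_{ab} = 0` (private monomials) -/
/-- `Z_((0,0), b) = 0` for the four cells `b` sharing neither row nor column with `(0,0)`. -/
theorem glAnn_perPoly_three_sep_00 {Z : Matrix (Fin 3 × Fin 3) (Fin 3 × Fin 3) ℂ}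
    (hZ : Z ∈ glAnn (perPoly (Fin 3) ℂ)) : Z (0, 0) (1, 1) = 0 ∧ Z (0, 0) (1, 2) = 0 ∧ Z (0, 0) (2, 1) = 0 ∧ Z (0, 0) (2, 2) = 0 := by
  have hZ' := sum_monomial_eq_zero_of_mem_glAnn_perPoly_three hZ
  have h0 := congr_arg (coeff (Multiset.toFinsupp ({(0, 0), (0, 0), (2, 2)} : Multiset (Fin 3 × Fin 3)))) hZ'
  simp (config := { decide := true }) only [coeff_smul, coeff_add, coeff_monomial,
      coeff_zero, Fintype.sum_prod_type, Fin.sum_univ_three, smul_eq_mul,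
      mul_one, mul_zero, add_zero, zero_add, if_true, if_false, Fin.isValue] at h0
  have h1 := congr_arg (coeff (Multiset.toFinsupp ({(0, 0), (0, 1), (2, 0)} : Multiset (Fin 3 × Fin 3)))) hZ'
  simp (config := { decide := true }) only [coeff_smul, coeff_add, coeff_monomial,
      coeff_zero, Fintype.sum_prod_type, Fin.sum_univ_three, smul_eq_mul,
      mul_one, mul_zero, add_zero, zero_add, if_true, if_false, Fin.isValue] at h1
  have h2 := congr_arg (coeff (Multiset.toFinsupp ({(0, 0), (0, 2), (1, 0)} : Multiset (Fin 3 × Fin 3)))) hZ'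
  simp (config := { decide := true }) only [coeff_smul, coeff_add, coeff_monomial,
      coeff_zero, Fintype.sum_prod_type, Fin.sum_univ_three, smul_eq_mul,
      mul_one, mul_zero, add_zero, zero_add, if_true, if_false, Fin.isValue] at h2
  have h3 := congr_arg (coeff (Multiset.toFinsupp ({(0, 0), (0, 0), (1, 1)} : Multiset (Fin 3 × Fin 3)))) hZ'
  simp (config := { decide := true }) only [coeff_smul, coeff_add, coeff_monomial,
      coeff_zero, Fintype.sum_prod_type, Fin.sum_univ_three, smul_eq_mul,
      mul_one, mul_zero, add_zero, zero_add, if_true, if_false, Fin.isValue] at h3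
  exact ⟨by linear_combination h0, by linear_combination h1, by linear_combination h2, by linear_combination h3⟩

/-- `Z_((0,1), b) = 0` for the four cells `b` sharing neither row nor column with `(0,1)`. -/
theorem glAnn_perPoly_three_sep_01 {Z : Matrix (Fin 3 × Fin 3) (Fin 3 × Fin 3) ℂ}
    (hZ : Z ∈ glAnn (perPoly (Fin 3) ℂ)) : Z (0, 1) (1, 0) = 0 ∧ Z (0, 1) (1, 2) = 0 ∧ Z (0, 1) (2, 0) = 0 ∧ Z (0, 1) (2, 2) = 0 := by
  have hZ' := sum_monomial_eq_zero_of_mem_glAnn_perPoly_three hZ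
  have h0 := congr_arg (coeff (Multiset.toFinsupp ({(0, 1), (0, 2), (2, 1)} : Multiset (Fin 3 × Fin 3)))) hZ'
  simp (config := { decide := true }) only [coeff_smul, coeff_add, coeff_monomial,
      coeff_zero, Fintype.sum_prod_type, Fin.sum_univ_three, smul_eq_mul,
      mul_one, mul_zero, add_zero, zero_add, if_true, if_false, Fin.isValue] at h0
  have h1 := congr_arg (coeff (Multiset.toFinsupp ({(0, 1), (0, 1), (2, 0)} : Multiset (Fin 3 × Fin 3)))) hZ'
  simp (config := { decide := true }) only [coeff_smul, coeff_add, coeff_monomial,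
      coeff_zero, Fintype.sum_prod_type, Fin.sum_univ_three, smul_eq_mul,
      mul_one, mul_zero, add_zero, zero_add, if_true, if_false, Fin.isValue] at h1
  have h2 := congr_arg (coeff (Multiset.toFinsupp ({(0, 1), (0, 1), (1, 2)} : Multiset (Fin 3 × Fin 3)))) hZ'
  simp (config := { decide := true }) only [coeff_smul, coeff_add, coeff_monomial,
      coeff_zero, Fintype.sum_prod_type, Fin.sum_univ_three, smul_eq_mul,
      mul_one, mul_zero, add_zero, zero_add, if_true, if_false, Fin.isValue] at h2
  have h3 := congr_arg (coeff (Multiset.toFinsupp ({(0, 0), (0, 1), (1, 1)} : Multiset (Fin 3 × Fin 3)))) hZ'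
  simp (config := { decide := true }) only [coeff_smul, coeff_add, coeff_monomial,
      coeff_zero, Fintype.sum_prod_type, Fin.sum_univ_three, smul_eq_mul,
      mul_one, mul_zero, add_zero, zero_add, if_true, if_false, Fin.isValue] at h3
  exact ⟨by linear_combination h0, by linear_combination h1, by linear_combination h2, by linear_combination h3⟩

/-- `Z_((0,2), b) = 0` for the four cells `b` sharing neither row nor column with `(0,2)`. -/
theorem glAnn_perPoly_three_sep_02 {Z : Matrix (Fin 3 × Fin 3) (Fin 3 × Fin 3) ℂ}
    (hZ : Z ∈ glAnn (perPoly (Fin 3) ℂ)) : Z (0, 2) (1, 0) = 0 ∧ Z (0, 2) (1, 1) = 0 ∧ Z (0, 2) (2, 0) = 0 ∧ Z (0, 2) (2, 1) = 0 := by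
  have hZ' := sum_monomial_eq_zero_of_mem_glAnn_perPoly_three hZ
  have h0 := congr_arg (coeff (Multiset.toFinsupp ({(0, 2), (0, 2), (2, 1)} : Multiset (Fin 3 × Fin 3)))) hZ'
  simp (config := { decide := true }) only [coeff_smul, coeff_add, coeff_monomial,
      coeff_zero, Fintype.sum_prod_type, Fin.sum_univ_three, smul_eq_mul,
      mul_one, mul_zero, add_zero, zero_add, if_true, if_false, Fin.isValue] at h0
  have h1 := congr_arg (coeff (Multiset.toFinsupp ({(0, 0), (0, 2), (2, 2)} : Multiset (Fin 3 × Fin 3)))) hZ'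
  simp (config := { decide := true }) only [coeff_smul, coeff_add, coeff_monomial,
      coeff_zero, Fintype.sum_prod_type, Fin.sum_univ_three, smul_eq_mul,
      mul_one, mul_zero, add_zero, zero_add, if_true, if_false, Fin.isValue] at h1
  have h2 := congr_arg (coeff (Multiset.toFinsupp ({(0, 1), (0, 2), (1, 2)} : Multiset (Fin 3 × Fin 3)))) hZ'
  simp (config := { decide := true }) only [coeff_smul, coeff_add, coeff_monomial,
      coeff_zero, Fintype.sum_prod_type, Fin.sum_univ_three, smul_eq_mul,
      mul_one, mul_zero, add_zero, zero_add, if_true, if_false, Fin.isValue] at h2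
  have h3 := congr_arg (coeff (Multiset.toFinsupp ({(0, 2), (0, 2), (1, 0)} : Multiset (Fin 3 × Fin 3)))) hZ'
  simp (config := { decide := true }) only [coeff_smul, coeff_add, coeff_monomial,
      coeff_zero, Fintype.sum_prod_type, Fin.sum_univ_three, smul_eq_mul,
      mul_one, mul_zero, add_zero, zero_add, if_true, if_false, Fin.isValue] at h3
  exact ⟨by linear_combination h0, by linear_combination h1, by linear_combination h2, by linear_combination h3⟩

/-- `Z_((1,0), b) = 0` for the four cells `b` sharing neither row nor column with `(1,0)`. -/
theorem glAnn_perPoly_three_sep_10 {Z : Matrix (Fin 3 × Fin 3) (Fin 3 × Fin 3) ℂ}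
    (hZ : Z ∈ glAnn (perPoly (Fin 3) ℂ)) : Z (1, 0) (0, 1) = 0 ∧ Z (1, 0) (0, 2) = 0 ∧ Z (1, 0) (2, 1) = 0 ∧ Z (1, 0) (2, 2) = 0 := by
  have hZ' := sum_monomial_eq_zero_of_mem_glAnn_perPoly_three hZ
  have h0 := congr_arg (coeff (Multiset.toFinsupp ({(1, 0), (1, 2), (2, 0)} : Multiset (Fin 3 × Fin 3)))) hZ'
  simp (config := { decide := true }) only [coeff_smul, coeff_add, coeff_monomial,
      coeff_zero, Fintype.sum_prod_type, Fin.sum_univ_three, smul_eq_mul,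
      mul_one, mul_zero, add_zero, zero_add, if_true, if_false, Fin.isValue] at h0
  have h1 := congr_arg (coeff (Multiset.toFinsupp ({(1, 0), (1, 0), (2, 1)} : Multiset (Fin 3 × Fin 3)))) hZ'
  simp (config := { decide := true }) only [coeff_smul, coeff_add, coeff_monomial,
      coeff_zero, Fintype.sum_prod_type, Fin.sum_univ_three, smul_eq_mul,
      mul_one, mul_zero, add_zero, zero_add, if_true, if_false, Fin.isValue] at h1
  have h2 := congr_arg (coeff (Multiset.toFinsupp ({(0, 2), (1, 0), (1, 0)} : Multiset (Fin 3 × Fin 3)))) hZ'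
  simp (config := { decide := true }) only [coeff_smul, coeff_add, coeff_monomial,
      coeff_zero, Fintype.sum_prod_type, Fin.sum_univ_three, smul_eq_mul,
      mul_one, mul_zero, add_zero, zero_add, if_true, if_false, Fin.isValue] at h2
  have h3 := congr_arg (coeff (Multiset.toFinsupp ({(0, 0), (1, 0), (1, 1)} : Multiset (Fin 3 × Fin 3)))) hZ'
  simp (config := { decide := true }) only [coeff_smul, coeff_add, coeff_monomial,
      coeff_zero, Fintype.sum_prod_type, Fin.sum_univ_three, smul_eq_mul,
      mul_one, mul_zero, add_zero, zero_add, if_true, if_false, Fin.isValue] at h3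
  exact ⟨by linear_combination h0, by linear_combination h1, by linear_combination h2, by linear_combination h3⟩

/-- `Z_((1,1), b) = 0` for the four cells `b` sharing neither row nor column with `(1,1)`. -/
theorem glAnn_perPoly_three_sep_11 {Z : Matrix (Fin 3 × Fin 3) (Fin 3 × Fin 3) ℂ}
    (hZ : Z ∈ glAnn (perPoly (Fin 3) ℂ)) : Z (1, 1) (0, 0) = 0 ∧ Z (1, 1) (0, 2) = 0 ∧ Z (1, 1) (2, 0) = 0 ∧ Z (1, 1) (2, 2) = 0 := by
  have hZ' := sum_monomial_eq_zero_of_mem_glAnn_perPoly_three hZ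
  have h0 := congr_arg (coeff (Multiset.toFinsupp ({(1, 1), (1, 1), (2, 2)} : Multiset (Fin 3 × Fin 3)))) hZ'
  simp (config := { decide := true }) only [coeff_smul, coeff_add, coeff_monomial,
      coeff_zero, Fintype.sum_prod_type, Fin.sum_univ_three, smul_eq_mul,
      mul_one, mul_zero, add_zero, zero_add, if_true, if_false, Fin.isValue] at h0
  have h1 := congr_arg (coeff (Multiset.toFinsupp ({(1, 0), (1, 1), (2, 1)} : Multiset (Fin 3 × Fin 3)))) hZ'
  simp (config := { decide := true }) only [coeff_smul, coeff_add, coeff_monomial,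
      coeff_zero, Fintype.sum_prod_type, Fin.sum_univ_three, smul_eq_mul,
      mul_one, mul_zero, add_zero, zero_add, if_true, if_false, Fin.isValue] at h1
  have h2 := congr_arg (coeff (Multiset.toFinsupp ({(0, 1), (1, 1), (1, 2)} : Multiset (Fin 3 × Fin 3)))) hZ'
  simp (config := { decide := true }) only [coeff_smul, coeff_add, coeff_monomial,
      coeff_zero, Fintype.sum_prod_type, Fin.sum_univ_three, smul_eq_mul,
      mul_one, mul_zero, add_zero, zero_add, if_true, if_false, Fin.isValue] at h2
  have h3 := congr_arg (coeff (Multiset.toFinsupp ({(0, 0), (1, 1), (1, 1)} : Multiset (Fin 3 × Fin 3)))) hZ'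
  simp (config := { decide := true }) only [coeff_smul, coeff_add, coeff_monomial,
      coeff_zero, Fintype.sum_prod_type, Fin.sum_univ_three, smul_eq_mul,
      mul_one, mul_zero, add_zero, zero_add, if_true, if_false, Fin.isValue] at h3
  exact ⟨by linear_combination h0, by linear_combination h1, by linear_combination h2, by linear_combination h3⟩

/-- `Z_((1,2), b) = 0` for the four cells `b` sharing neither row nor column with `(1,2)`. -/
theorem glAnn_perPoly_three_sep_12 {Z : Matrix (Fin 3 × Fin 3) (Fin 3 × Fin 3) ℂ}
    (hZ : Z ∈ glAnn (perPoly (Fin 3) ℂ)) : Z (1, 2) (0, 0) = 0 ∧ Z (1, 2) (0, 1) = 0 ∧ Z (1, 2) (2, 0) = 0 ∧ Z (1, 2) (2, 1) = 0 := by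
  have hZ' := sum_monomial_eq_zero_of_mem_glAnn_perPoly_three hZ
  have h0 := congr_arg (coeff (Multiset.toFinsupp ({(1, 1), (1, 2), (2, 2)} : Multiset (Fin 3 × Fin 3)))) hZ'
  simp (config := { decide := true }) only [coeff_smul, coeff_add, coeff_monomial,
      coeff_zero, Fintype.sum_prod_type, Fin.sum_univ_three, smul_eq_mul,
      mul_one, mul_zero, add_zero, zero_add, if_true, if_false, Fin.isValue] at h0
  have h1 := congr_arg (coeff (Multiset.toFinsupp ({(1, 2), (1, 2), (2, 0)} : Multiset (Fin 3 × Fin 3)))) hZ'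
  simp (config := { decide := true }) only [coeff_smul, coeff_add, coeff_monomial,
      coeff_zero, Fintype.sum_prod_type, Fin.sum_univ_three, smul_eq_mul,
      mul_one, mul_zero, add_zero, zero_add, if_true, if_false, Fin.isValue] at h1
  have h2 := congr_arg (coeff (Multiset.toFinsupp ({(0, 1), (1, 2), (1, 2)} : Multiset (Fin 3 × Fin 3)))) hZ'
  simp (config := { decide := true }) only [coeff_smul, coeff_add, coeff_monomial,
      coeff_zero, Fintype.sum_prod_type, Fin.sum_univ_three, smul_eq_mul,
      mul_one, mul_zero, add_zero, zero_add, if_true, if_false, Fin.isValue] at h2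
  have h3 := congr_arg (coeff (Multiset.toFinsupp ({(0, 2), (1, 0), (1, 2)} : Multiset (Fin 3 × Fin 3)))) hZ'
  simp (config := { decide := true }) only [coeff_smul, coeff_add, coeff_monomial,
      coeff_zero, Fintype.sum_prod_type, Fin.sum_univ_three, smul_eq_mul,
      mul_one, mul_zero, add_zero, zero_add, if_true, if_false, Fin.isValue] at h3
  exact ⟨by linear_combination h0, by linear_combination h1, by linear_combination h2, by linear_combination h3⟩

/-- `Z_((2,0), b) = 0` for the four cells `b` sharing neither row nor column with `(2,0)`. -/
theorem glAnn_perPoly_three_sep_20 {Z : Matrix (Fin 3 × Fin 3) (Fin 3 × Fin 3) ℂ}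
    (hZ : Z ∈ glAnn (perPoly (Fin 3) ℂ)) : Z (2, 0) (0, 1) = 0 ∧ Z (2, 0) (0, 2) = 0 ∧ Z (2, 0) (1, 1) = 0 ∧ Z (2, 0) (1, 2) = 0 := by
  have hZ' := sum_monomial_eq_zero_of_mem_glAnn_perPoly_three hZ
  have h0 := congr_arg (coeff (Multiset.toFinsupp ({(1, 2), (2, 0), (2, 0)} : Multiset (Fin 3 × Fin 3)))) hZ'
  simp (config := { decide := true }) only [coeff_smul, coeff_add, coeff_monomial,
      coeff_zero, Fintype.sum_prod_type, Fin.sum_univ_three, smul_eq_mul,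
      mul_one, mul_zero, add_zero, zero_add, if_true, if_false, Fin.isValue] at h0
  have h1 := congr_arg (coeff (Multiset.toFinsupp ({(1, 0), (2, 0), (2, 1)} : Multiset (Fin 3 × Fin 3)))) hZ'
  simp (config := { decide := true }) only [coeff_smul, coeff_add, coeff_monomial,
      coeff_zero, Fintype.sum_prod_type, Fin.sum_univ_three, smul_eq_mul,
      mul_one, mul_zero, add_zero, zero_add, if_true, if_false, Fin.isValue] at h1
  have h2 := congr_arg (coeff (Multiset.toFinsupp ({(0, 0), (2, 0), (2, 2)} : Multiset (Fin 3 × Fin 3)))) hZ'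
  simp (config := { decide := true }) only [coeff_smul, coeff_add, coeff_monomial,
      coeff_zero, Fintype.sum_prod_type, Fin.sum_univ_three, smul_eq_mul,
      mul_one, mul_zero, add_zero, zero_add, if_true, if_false, Fin.isValue] at h2
  have h3 := congr_arg (coeff (Multiset.toFinsupp ({(0, 1), (2, 0), (2, 0)} : Multiset (Fin 3 × Fin 3)))) hZ'
  simp (config := { decide := true }) only [coeff_smul, coeff_add, coeff_monomial,
      coeff_zero, Fintype.sum_prod_type, Fin.sum_univ_three, smul_eq_mul,
      mul_one, mul_zero, add_zero, zero_add, if_true, if_false, Fin.isValue] at h3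
  exact ⟨by linear_combination h0, by linear_combination h1, by linear_combination h2, by linear_combination h3⟩

/-- `Z_((2,1), b) = 0` for the four cells `b` sharing neither row nor column with `(2,1)`. -/
theorem glAnn_perPoly_three_sep_21 {Z : Matrix (Fin 3 × Fin 3) (Fin 3 × Fin 3) ℂ}
    (hZ : Z ∈ glAnn (perPoly (Fin 3) ℂ)) : Z (2, 1) (0, 0) = 0 ∧ Z (2, 1) (0, 2) = 0 ∧ Z (2, 1) (1, 0) = 0 ∧ Z (2, 1) (1, 2) = 0 := by
  have hZ' := sum_monomial_eq_zero_of_mem_glAnn_perPoly_three hZ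
  have h0 := congr_arg (coeff (Multiset.toFinsupp ({(1, 1), (2, 1), (2, 2)} : Multiset (Fin 3 × Fin 3)))) hZ'
  simp (config := { decide := true }) only [coeff_smul, coeff_add, coeff_monomial,
      coeff_zero, Fintype.sum_prod_type, Fin.sum_univ_three, smul_eq_mul,
      mul_one, mul_zero, add_zero, zero_add, if_true, if_false, Fin.isValue] at h0
  have h1 := congr_arg (coeff (Multiset.toFinsupp ({(1, 0), (2, 1), (2, 1)} : Multiset (Fin 3 × Fin 3)))) hZ'
  simp (config := { decide := true }) only [coeff_smul, coeff_add, coeff_monomial,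
      coeff_zero, Fintype.sum_prod_type, Fin.sum_univ_three, smul_eq_mul,
      mul_one, mul_zero, add_zero, zero_add, if_true, if_false, Fin.isValue] at h1
  have h2 := congr_arg (coeff (Multiset.toFinsupp ({(0, 2), (2, 1), (2, 1)} : Multiset (Fin 3 × Fin 3)))) hZ'
  simp (config := { decide := true }) only [coeff_smul, coeff_add, coeff_monomial,
      coeff_zero, Fintype.sum_prod_type, Fin.sum_univ_three, smul_eq_mul,
      mul_one, mul_zero, add_zero, zero_add, if_true, if_false, Fin.isValue] at h2
  have h3 := congr_arg (coeff (Multiset.toFinsupp ({(0, 1), (2, 0), (2, 1)} : Multiset (Fin 3 × Fin 3)))) hZ'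
  simp (config := { decide := true }) only [coeff_smul, coeff_add, coeff_monomial,
      coeff_zero, Fintype.sum_prod_type, Fin.sum_univ_three, smul_eq_mul,
      mul_one, mul_zero, add_zero, zero_add, if_true, if_false, Fin.isValue] at h3
  exact ⟨by linear_combination h0, by linear_combination h1, by linear_combination h2, by linear_combination h3⟩

/-- `Z_((2,2), b) = 0` for the four cells `b` sharing neither row nor column with `(2,2)`. -/
theorem glAnn_perPoly_three_sep_22 {Z : Matrix (Fin 3 × Fin 3) (Fin 3 × Fin 3) ℂ}
    (hZ : Z ∈ glAnn (perPoly (Fin 3) ℂ)) : Z (2, 2) (0, 0) = 0 ∧ Z (2, 2) (0, 1) = 0 ∧ Z (2, 2) (1, 0) = 0 ∧ Z (2, 2) (1, 1) = 0 := by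
  have hZ' := sum_monomial_eq_zero_of_mem_glAnn_perPoly_three hZ
  have h0 := congr_arg (coeff (Multiset.toFinsupp ({(1, 1), (2, 2), (2, 2)} : Multiset (Fin 3 × Fin 3)))) hZ'
  simp (config := { decide := true }) only [coeff_smul, coeff_add, coeff_monomial,
      coeff_zero, Fintype.sum_prod_type, Fin.sum_univ_three, smul_eq_mul,
      mul_one, mul_zero, add_zero, zero_add, if_true, if_false, Fin.isValue] at h0
  have h1 := congr_arg (coeff (Multiset.toFinsupp ({(1, 2), (2, 0), (2, 2)} : Multiset (Fin 3 × Fin 3)))) hZ'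
  simp (config := { decide := true }) only [coeff_smul, coeff_add, coeff_monomial,
      coeff_zero, Fintype.sum_prod_type, Fin.sum_univ_three, smul_eq_mul,
      mul_one, mul_zero, add_zero, zero_add, if_true, if_false, Fin.isValue] at h1
  have h2 := congr_arg (coeff (Multiset.toFinsupp ({(0, 2), (2, 1), (2, 2)} : Multiset (Fin 3 × Fin 3)))) hZ'
  simp (config := { decide := true }) only [coeff_smul, coeff_add, coeff_monomial,
      coeff_zero, Fintype.sum_prod_type, Fin.sum_univ_three, smul_eq_mul,
      mul_one, mul_zero, add_zero, zero_add, if_true, if_false, Fin.isValue] at h2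
  have h3 := congr_arg (coeff (Multiset.toFinsupp ({(0, 0), (2, 2), (2, 2)} : Multiset (Fin 3 × Fin 3)))) hZ'
  simp (config := { decide := true }) only [coeff_smul, coeff_add, coeff_monomial,
      coeff_zero, Fintype.sum_prod_type, Fin.sum_univ_three, smul_eq_mul,
      mul_one, mul_zero, add_zero, zero_add, if_true, if_false, Fin.isValue] at h3
  exact ⟨by linear_combination h0, by linear_combination h1, by linear_combination h2, by linear_combination h3⟩

/-- **Cells differing in row and column**: `Z_{ab} = 0` whenever `a` and `b` share neither a row nor a
column (the monomial `x_a x_(b+(1,1)) x_(b+(2,2))` of `x_a ∂_b per_3` occurs in no other `x_(a') ∂_(b') per_3`). -/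
theorem glAnn_perPoly_three_apply_eq_zero_of_ne_of_ne
    {Z : Matrix (Fin 3 × Fin 3) (Fin 3 × Fin 3) ℂ} (hZ : Z ∈ glAnn (perPoly (Fin 3) ℂ))
    (a b : Fin 3 × Fin 3) (h1 : a.1 ≠ b.1) (h2 : a.2 ≠ b.2) : Z a b = 0 := by
  obtain ⟨s00a, s00b, s00c, s00d⟩ := glAnn_perPoly_three_sep_00 hZ
  obtain ⟨s01a, s01b, s01c, s01d⟩ := glAnn_perPoly_three_sep_01 hZ
  obtain ⟨s02a, s02b, s02c, s02d⟩ := glAnn_perPoly_three_sep_02 hZ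
  obtain ⟨s10a, s10b, s10c, s10d⟩ := glAnn_perPoly_three_sep_10 hZ
  obtain ⟨s11a, s11b, s11c, s11d⟩ := glAnn_perPoly_three_sep_11 hZ
  obtain ⟨s12a, s12b, s12c, s12d⟩ := glAnn_perPoly_three_sep_12 hZ
  obtain ⟨s20a, s20b, s20c, s20d⟩ := glAnn_perPoly_three_sep_20 hZ
  obtain ⟨s21a, s21b, s21c, s21d⟩ := glAnn_perPoly_three_sep_21 hZ
  obtain ⟨s22a, s22b, s22c, s22d⟩ := glAnn_perPoly_three_sep_22 hZ
  obtain ⟨i, j⟩ := a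
  obtain ⟨r, c⟩ := b
  fin_cases i <;> fin_cases j <;> fin_cases r <;> fin_cases c <;>
    first
    | exact absurd rfl h1
    | exact absurd rfl h2
    | assumption

end Summit.ValiantsHypothesis.ValiantsHypothesis.Theorems.SchenstedIndex

end
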